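import Summits.AtomisticToContinuum.Crystallization.Theorems.FrustratedLawDichotomyCellAdmissible

/-!
# FrustratedLawDichotomy · crux `AperiodicFrustratedLawGap` (stmt-AtomisticToContinuum-27623) — CELL-SOUND VII: DECIDABLE CELL DATA
(cell decomp-a2c, lens-5 g113; continues `…CellAdmissible`; K-file format co-design, crit r1767 (3))

A class-A K-file carries ~10²–10³ labels; its label-side facts (separation of all pairs, windows, list side conditions) must be decided by
the kernel over `ℚ`, not by `norm_num` per pair.  This file supplies the two bridges:
1. `gramLoQ`, `gramHiQ` — the `ℚ` mirrors of the two-corner sums of `…CellAdmissible`, with `cast_gramLoQ`, `cast_gramHiQ`: a corner fact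
   decided in `ℚ` IS the real corner fact for the cast box `Glo.map (↑)`, `Ghi.map (↑)` and the cast label data.
2. NEAR-IDENTITY METRIC BOXES (the strain boxes of ATLAS EDITION 1 are `|FᵀF − 1| ≤ ε` entrywise around a Cartesian template):
   `gram_ge_nearId`, `gram_le_nearId` — `(1 − 3ε)·|u|² ≤ gram (FᵀF) u u ≤ (1 + 3ε)·|u|²` (eigenvalue-free), hence `le_dist_of_nearId`,
   `lt_dist_of_nearId`, `norm_add_le_of_nearId`, `inset_of_nearId`, `le_norm_of_nearId`: every admissibility clause and list side condition
   from ONE rational `|a m − a m'|²` per pair / `|a m|²` per label, and ★ `rowFloor_of_nearIdBox` = `…CellFrame.rowFloor_of_cells` over a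
   near-identity box with the admissibility clauses replaced by such facts (`decide` over a `ℚ` template, then `exact_mod_cast`).

House conventions: SI units · italic scalars, bold vectors, sans-serif tensors · numbered formulae only when referenced · en-dash for
ranges · References = cited works, numbered, alphabetical · no footnotes; Remarks at section ends · British spelling, -ise · Lennard-Jones
hyphenated; NASH capitalised as the Statement's notion · "folklore" tags standard bookkeeping; no new references are cited in this file.
-/

noncomputable section

namespace Summit.AtomisticToContinuum.Crystallization.Theorems.FrustratedLawDichotomyCellData

open MeasureTheory Metric Set RealInnerProductSpace
open scoped BigOperators
open Literature.MathematicalPhysics.StatisticalMechanics (lennardJones rootEnergy)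
open Literature.Probability.Process (IsRootedHardCore)
open Summit.AtomisticToContinuum.Crystallization.Theorems.ChargedEnergyGapNegative (E3)
open Summit.AtomisticToContinuum.Crystallization.Theorems.FrustratedLawDichotomyCoherentSets (coherentAt)
open Summit.AtomisticToContinuum.Crystallization.Theorems.FrustratedLawDichotomyCoherentFloorAlgebra
open Summit.AtomisticToContinuum.Crystallization.Theorems.FrustratedLawDichotomyCoherentFloor
open Summit.AtomisticToContinuum.Crystallization.Theorems.FrustratedLawDichotomyCellFrame
open Summit.AtomisticToContinuum.Crystallization.Theorems.FrustratedLawDichotomyCellMetric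
open Summit.AtomisticToContinuum.Crystallization.Theorems.FrustratedLawDichotomyCellAdmissible

variable {ι : Type*} [DecidableEq ι]

/-! ## §1. `ℚ` mirrors of the two-corner sums -/

/-- `ℚ` mirror of `gramLo`. -/
def gramLoQ (Glo Ghi : Matrix (Fin 3) (Fin 3) ℚ) (v w : Fin 3 → ℚ) : ℚ := ∑ i, ∑ j, min (Glo i j * (v i * w j)) (Ghi i j * (v i * w j))

/-- `ℚ` mirror of `gramHi`. -/
def gramHiQ (Glo Ghi : Matrix (Fin 3) (Fin 3) ℚ) (v w : Fin 3 → ℚ) : ℚ := ∑ i, ∑ j, max (Glo i j * (v i * w j)) (Ghi i j * (v i * w j))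

omit [DecidableEq ι] in
/-- [folklore] -/
theorem cast_gramLoQ (Glo Ghi : Matrix (Fin 3) (Fin 3) ℚ) (v w : Fin 3 → ℚ) :
    ((gramLoQ Glo Ghi v w : ℚ) : ℝ) = gramLo (Glo.map (fun q : ℚ => (q : ℝ))) (Ghi.map (fun q : ℚ => (q : ℝ))) (fun i => (v i : ℝ))
      (fun i => (w i : ℝ)) := by
  unfold gramLoQ gramLo
  push_cast [Matrix.map_apply]
  rfl

omit [DecidableEq ι] in
/-- [folklore] -/
theorem cast_gramHiQ (Glo Ghi : Matrix (Fin 3) (Fin 3) ℚ) (v w : Fin 3 → ℚ) :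
    ((gramHiQ Glo Ghi v w : ℚ) : ℝ) = gramHi (Glo.map (fun q : ℚ => (q : ℝ))) (Ghi.map (fun q : ℚ => (q : ℝ))) (fun i => (v i : ℝ))
      (fun i => (w i : ℝ)) := by
  unfold gramHiQ gramHi
  push_cast [Matrix.map_apply]
  rfl

/-! ## §2. Near-identity metric boxes -/

section NearId

variable {F : Matrix (Fin 3) (Fin 3) ℝ} {ε : ℝ}

omit [DecidableEq ι] in
/-- ★ eigenvalue-free LOWER bound on a near-identity metric box: `|G − 1| ≤ ε` entrywise ⇒ `(1 − 3ε)|u|² ≤ gram G u u`. [folklore] -/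
theorem gram_ge_nearId {G : Matrix (Fin 3) (Fin 3) ℝ} (h : ∀ i j, |G i j - (if i = j then 1 else 0)| ≤ ε) (u : Fin 3 → ℝ) :
    (1 - 3 * ε) * ∑ i, u i ^ 2 ≤ gram G u u := by
  unfold gram
  simp only [Fin.sum_univ_three]
  have h00 := h 0 0; have h01 := h 0 1; have h02 := h 0 2; have h10 := h 1 0; have h11 := h 1 1; have h12 := h 1 2
  have h20 := h 2 0; have h21 := h 2 1; have h22 := h 2 2
  simp at h00 h01 h02 h10 h11 h12 h20 h21 h22
  rw [abs_le] at h00 h01 h02 h10 h11 h12 h20 h21 h22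
  nlinarith [sq_nonneg (u 0 - u 1), sq_nonneg (u 0 + u 1), sq_nonneg (u 0 - u 2), sq_nonneg (u 0 + u 2), sq_nonneg (u 1 - u 2),
    sq_nonneg (u 1 + u 2), sq_nonneg (u 0), sq_nonneg (u 1), sq_nonneg (u 2)]

omit [DecidableEq ι] in
/-- ★ eigenvalue-free UPPER bound: `|G − 1| ≤ ε` entrywise ⇒ `gram G u u ≤ (1 + 3ε)|u|²`. [folklore] -/
theorem gram_le_nearId {G : Matrix (Fin 3) (Fin 3) ℝ} (h : ∀ i j, |G i j - (if i = j then 1 else 0)| ≤ ε) (u : Fin 3 → ℝ) :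
    gram G u u ≤ (1 + 3 * ε) * ∑ i, u i ^ 2 := by
  unfold gram
  simp only [Fin.sum_univ_three]
  have h00 := h 0 0; have h01 := h 0 1; have h02 := h 0 2; have h10 := h 1 0; have h11 := h 1 1; have h12 := h 1 2
  have h20 := h 2 0; have h21 := h 2 1; have h22 := h 2 2
  simp at h00 h01 h02 h10 h11 h12 h20 h21 h22
  rw [abs_le] at h00 h01 h02 h10 h11 h12 h20 h21 h22
  nlinarith [sq_nonneg (u 0 - u 1), sq_nonneg (u 0 + u 1), sq_nonneg (u 0 - u 2), sq_nonneg (u 0 + u 2), sq_nonneg (u 1 - u 2),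
    sq_nonneg (u 1 + u 2), sq_nonneg (u 0), sq_nonneg (u 1), sq_nonneg (u 2)]

omit [DecidableEq ι] in
/-- squared-norm window of a placed label vector on a near-identity box. [folklore] -/
theorem norm_sq_mem_nearId (h : ∀ i j, |(F.transpose * F) i j - (if i = j then 1 else 0)| ≤ ε) (v : Fin 3 → ℝ) :
    (1 - 3 * ε) * ∑ i, v i ^ 2 ≤ ‖posL F v‖ ^ 2 ∧ ‖posL F v‖ ^ 2 ≤ (1 + 3 * ε) * ∑ i, v i ^ 2 := by
  rw [norm_sq_posL]
  exact ⟨gram_ge_nearId h v, gram_le_nearId h v⟩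

omit [DecidableEq ι] in
/-- LOWER DISTANCE on a near-identity box: `c² ≤ (1 − 3ε)·|v − w|²` ⇒ `c ≤ dist`. [folklore] -/
theorem le_dist_of_nearId (h : ∀ i j, |(F.transpose * F) i j - (if i = j then 1 else 0)| ≤ ε) {v w : Fin 3 → ℝ} {c : ℝ}
    (hc : c ^ 2 ≤ (1 - 3 * ε) * ∑ i, (v i - w i) ^ 2) : c ≤ dist (posL F v) (posL F w) := by
  rw [dist_posL]
  refine le_norm_posL' (hc.trans ?_)
  have := gram_ge_nearId h (v - w)
  simpa only [Pi.sub_apply] using this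

omit [DecidableEq ι] in
/-- STRICT LOWER DISTANCE on a near-identity box: `c² < (1 − 3ε)·|v − w|²` ⇒ `c < dist`. [folklore] -/
theorem lt_dist_of_nearId (h : ∀ i j, |(F.transpose * F) i j - (if i = j then 1 else 0)| ≤ ε) {v w : Fin 3 → ℝ} {c : ℝ}
    (hc : c ^ 2 < (1 - 3 * ε) * ∑ i, (v i - w i) ^ 2) : c < dist (posL F v) (posL F w) := by
  rw [dist_posL]
  refine lt_norm_posL (hc.trans_le ?_)
  have := gram_ge_nearId h (v - w)
  simpa only [Pi.sub_apply] using this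

omit [DecidableEq ι] in
/-- LOWER NORM on a near-identity box. [folklore] -/
theorem le_norm_of_nearId (h : ∀ i j, |(F.transpose * F) i j - (if i = j then 1 else 0)| ≤ ε) {v : Fin 3 → ℝ} {c : ℝ}
    (hc : c ^ 2 ≤ (1 - 3 * ε) * ∑ i, v i ^ 2) : c ≤ ‖posL F v‖ :=
  le_norm_posL' (hc.trans (gram_ge_nearId h v))

omit [DecidableEq ι] in
/-- WINDOW on a near-identity box: `(1 + 3ε)|v|² ≤ (R − τ)²`, `0 ≤ R − τ` ⇒ `‖posL F v‖ + τ ≤ R`. [folklore] -/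
theorem norm_add_le_of_nearId (h : ∀ i j, |(F.transpose * F) i j - (if i = j then 1 else 0)| ≤ ε) {v : Fin 3 → ℝ} {R τ : ℝ}
    (hR : 0 ≤ R - τ) (hv : (1 + 3 * ε) * ∑ i, v i ^ 2 ≤ (R - τ) ^ 2) : ‖posL F v‖ + τ ≤ R := by
  have h2 := (norm_sq_mem_nearId h v).2.trans hv
  have h3 := (pow_le_pow_iff_left₀ (norm_nonneg _) hR two_ne_zero).mp h2
  linarith

omit [DecidableEq ι] in
/-- INTERIOR INSET on a near-identity box: `(1 + 3ε)|v|² ≤ (R − τ − d)²`, `0 ≤ R − τ − d` ⇒ `d ≤ R − (‖posL F v‖ + τ)`. [folklore] -/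
theorem inset_of_nearId (h : ∀ i j, |(F.transpose * F) i j - (if i = j then 1 else 0)| ≤ ε) {v : Fin 3 → ℝ} {R τ d : ℝ}
    (hR : 0 ≤ R - τ - d) (hv : (1 + 3 * ε) * ∑ i, v i ^ 2 ≤ (R - τ - d) ^ 2) : d ≤ R - (‖posL F v‖ + τ) := by
  have h2 := (norm_sq_mem_nearId h v).2.trans hv
  have h3 := (pow_le_pow_iff_left₀ (norm_nonneg _) hR two_ne_zero).mp h2
  linarith

omit [DecidableEq ι] in
/-- UPPER NORM on a near-identity box: `(1 + 3ε)|v|² ≤ b²`, `0 ≤ b` ⇒ `‖posL F v‖ ≤ b`. [folklore] -/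
theorem norm_le_of_nearId (h : ∀ i j, |(F.transpose * F) i j - (if i = j then 1 else 0)| ≤ ε) {v : Fin 3 → ℝ} {b : ℝ}
    (hb : 0 ≤ b) (hv : (1 + 3 * ε) * ∑ i, v i ^ 2 ≤ b ^ 2) : ‖posL F v‖ ≤ b :=
  (pow_le_pow_iff_left₀ (norm_nonneg _) hb two_ne_zero).mp ((norm_sq_mem_nearId h v).2.trans hv)

end NearId

/-! ## §3. ★ The class-A row floor over a near-identity box from template facts -/

/-- ★★ **ROW FLOOR OF A NEAR-IDENTITY STRAIN-BOX CELL.**  A Cartesian template `a : ι → Fin 3 → ℝ` (`a o = 0`), a parameter set `B` of cell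
matrices with `|FᵀF − 1| ≤ ε` entrywise, placements `posL F (a m)`, any multipliers `YF F`.  If the TEMPLATE facts hold — `(2τ)² <
(1 − 3ε)|a m − a m'|²` for distinct labels, `(1 + 3ε)|a m|² ≤ (Rc − τ)²` on the template, `(1 + 3ε)|a m|² ≤ (Rc − τ − 7/20)²` on the interior
(for a `ℚ` template: ONE `decide`, then `exact_mod_cast`) — and every placement is CERTIFIED, then the row floor holds:
`…CellFrame.rowFloor_of_cells` with its admissibility clauses discharged uniformly over the box. [folklore] -/
theorem rowFloor_of_nearIdBox (ε : ℝ) (B : Set (Matrix (Fin 3) (Fin 3) ℝ))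
    (hB : ∀ F ∈ B, ∀ i j, |(F.transpose * F) i j - (if i = j then 1 else 0)| ≤ ε)
    (M MI : Finset ι) (o : ι) (a : ι → Fin 3 → ℝ) (YF : Matrix (Fin 3) (Fin 3) ℝ → ι → E3) {τ Rc c mc : ℝ}
    (hτ0 : 0 ≤ τ) (hτ : 2 * τ < 7 / 10) (hRc : 1 ≤ Rc) (ho : o ∈ M) (hMI : MI ⊆ M) (ha0 : a o = 0)
    (hsep : ∀ m ∈ M, ∀ m' ∈ M, m ≠ m' → (2 * τ) ^ 2 < (1 - 3 * ε) * ∑ i, (a m i - a m' i) ^ 2)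
    (hRcτ : 0 ≤ Rc - τ) (hin : ∀ m ∈ M, (1 + 3 * ε) * ∑ i, a m i ^ 2 ≤ (Rc - τ) ^ 2)
    (hRcI : 0 ≤ Rc - τ - 7 / 20) (hI : ∀ m ∈ MI, (1 + 3 * ε) * ∑ i, a m i ^ 2 ≤ (Rc - τ - 7 / 20) ^ 2)
    {cUp : ℝ} (hc : c ≤ cUp) (hcert : ∀ F ∈ B, 2 * (cUp + mc) ≤ certFloorL M MI o (fun m => posL F (a m)) (YF F) τ Rc)
    (μ : Measure E3) (hμ : IsRootedHardCore (7 / 10) μ)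
    (hNash : ∀ p : E3, μ {p} ≠ 0 → ∀ w : E3, (∀ q : E3, μ {q} ≠ 0 → q ≠ p → w ≠ q) →
      ∑' q : {q : E3 // μ {q} ≠ 0 ∧ q ≠ p}, lennardJones (dist p (q : E3)) ≤
        ∑' q : {q : E3 // μ {q} ≠ 0 ∧ q ≠ p}, lennardJones (dist w (q : E3)))
    (hrow : μ ∈ ⋃ F ∈ B, coherentAt (M.image fun m => posL F (a m)) τ Rc) :
    c + mc ≤ rootEnergy lennardJones μ := by
  refine rowFloor_of_cells B M MI o (fun F m => posL F (a m)) YF hτ0 hτ hRc ho hMI ?_ ?_ ?_ ?_ hc hcert μ hμ hNash hrow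
  · intro F _
    show posL F (a o) = 0
    rw [ha0, posL_zero]
  · intro F hF m hm m' hm' hne
    exact lt_dist_of_nearId (hB F hF) (hsep m hm m' hm' hne)
  · intro F hF m hm
    exact norm_add_le_of_nearId (hB F hF) hRcτ (hin m hm)
  · intro F hF m hm
    exact inset_of_nearId (hB F hF) hRcI (hI m hm)

omit [DecidableEq ι] in
/-- The `decide`-then-cast pattern for a `ℚ` template: template facts decided in `ℚ` transfer to the real template `fun m i => (aq m i : ℝ)`.
(Stated for the separation clause; the window clauses are the same one-liner.) [folklore] -/
theorem sep_cast {aq : ι → Fin 3 → ℚ} {M : Finset ι} {k c : ℚ}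
    (h : ∀ m ∈ M, ∀ m' ∈ M, m ≠ m' → c < k * ∑ i, (aq m i - aq m' i) ^ 2) :
    ∀ m ∈ M, ∀ m' ∈ M, m ≠ m' → (c : ℝ) < (k : ℝ) * ∑ i, ((aq m i : ℝ) - (aq m' i : ℝ)) ^ 2 := by
  intro m hm m' hm' hne
  have := h m hm m' hm' hne
  exact_mod_cast this

omit [DecidableEq ι] in
/-- Same pattern for a window clause. [folklore] -/
theorem win_cast {aq : ι → Fin 3 → ℚ} {M : Finset ι} {k c : ℚ} (h : ∀ m ∈ M, k * ∑ i, aq m i ^ 2 ≤ c) :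
    ∀ m ∈ M, (k : ℝ) * ∑ i, (aq m i : ℝ) ^ 2 ≤ (c : ℝ) := by
  intro m hm
  have := h m hm
  exact_mod_cast this

end Summit.AtomisticToContinuum.Crystallization.Theorems.FrustratedLawDichotomyCellData

end
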